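import Summits.BirchSwinnertonDyer.Rank1Residual.X11b.Three.LambdaSupplyPadicUnits
import Mathlib.NumberTheory.Padics.AddChar
import HarnessLib

/-!
# X11b @ `p = 3`, S24-a (λ-supply), part (D-II): the prime-to-`p` (Teichmüller) part of a character
# and `ℤ_p`-powers of principal units, in a complete ultrametric `ℚ_p`-algebra

HONEST FRAMING (cell `b2b-bsdres`, run/shared/lean/b2b/bsd-rank1-residual/, verbatim in every
file): the goal of the cell is to DELETE the COMBINATION-SHAPED residual classes of the
Birch–Swinnerton-Dyer formula for ALL analytic-rank `≤ 1` elliptic curves over `ℚ` — assembled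
STRICTLY from published theorems — so that the rank-`≤ 1` remainder becomes exactly the
CONSTRUCTION-SHAPED classes, which are TYPED, NOT attempted. This is not "finishing BSD". Team N8/O2
(X11b at `3`: `3 ‖ N`, `r_an = 1`, `E[3]` irreducible): research route; nothing booked; NO label
changes; O2 stays OPEN. THEOREMS ONLY (elementary `p`-adic analysis); no definition, no fact, no
`sorry`.

PROVENANCE: sub-target S24 'λ-SUPPLY SPLIT' (OWNERS R7-59), seat `b2b-bsdres-x11b3-p7` (gen. 4);
feasibility census `HOME/b2b-bsdres-x11b3-p7/s24/S24-FEASIBILITY.md` step (D) "3-adic toolkit",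
continued from `LambdaSupplyPadicUnits.lean` (same setting: a normed field `F`, normed
`ℚ_p`-algebra, ultrametric, COMPLETE; `P` = principal units, receptacle-style).

## What this file proves

* §4 **Teichmüller splitting without residue fields** (`exists_teichmueller_splitting`): a
  homomorphism `g : G →* Fˣ` with `g^T` principal-unit-valued, `p ∤ T`, factors as `g = ω · h` with
  `ω^T = 1`, `h` principal-unit-valued and `ω = 1` wherever `g` is already principal
  (`ω(σ) = lim_n g(σ)^{e_n}`, `e_n ≡ 1 (mod T)`, `p^n ∣ e_n`; Washington §5.1 `ω(a) = lim a^{p^n}`).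
  Used for the finite-order twist that makes the `3`-adic avatar of the auxiliary Hecke character
  principal-unit-valued (census §2 (D1)).
* §5 **`ℤ_p`-powers** (`exists_zpPow`): for a principal unit `b`, the continuous character
  `x ↦ b^x : ℤ_p → Fˣ` with `b^1 = b` and `‖1 - b^x‖ ≤ ‖1 - b‖` (Mathlib's Mahler-series character
  `PadicInt.addChar_of_value_at_one`). Used for the character `σ ↦ b₀^{Φ₀ σ} b₁^{Φ₁ σ}` through
  `Gal(K̃_∞/K)` (census §2 (D2)).

## References

* [Washington1997] L. C. Washington, *Introduction to Cyclotomic Fields*, §5.1 (the functions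
  `(1+q)^x`; the Teichmüller character `ω(a) = lim a^{p^n}`).
* [Serre1973] J.-P. Serre, *A Course in Arithmetic*, Ch. II §3.
-/

noncomputable section

open Filter Topology

namespace Summit.BirchSwinnertonDyer.Rank1Residual.X11b.Three.LambdaSupply.PadicUnits

open Literature.NumberTheory.Transcendental Literature.NumberTheory.Transcendental.IwasawaLog

variable {p : ℕ} [Fact p.Prime] {F : Type*} [NormedField F] [instF : NormedAlgebra ℚ_[p] F]
  [IsUltrametricDist F]

/-! ### §4. The prime-to-`p` part of a character (Teichmüller splitting) -/

section Teichmueller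

omit instF in
/-- `‖1 - y^k‖ ≤ ‖1 - y‖` for a principal unit `y`. [folklore] -/
theorem norm_one_sub_pow_le {y : F} (hy : ‖1 - y‖ < 1) (k : ℕ) : ‖1 - y ^ k‖ ≤ ‖1 - y‖ := by
  induction k with
  | zero => simp
  | succ k ih =>
    have : (1 : F) - y ^ (k + 1) = (1 - y ^ k) + y ^ k * (1 - y) := by ring
    rw [this]
    refine (IsUltrametricDist.norm_add_le_max _ _).trans (max_le ih ?_)
    rw [norm_mul, norm_pow, norm_eq_one_of_norm_one_sub_lt hy, one_pow, one_mul]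

omit instF [IsUltrametricDist F] in
/-- `‖1 - y⁻¹‖ = ‖1 - y‖` for a unit `y` of norm `1`. [folklore] -/
theorem norm_one_sub_inv_eq {y : F} (hy : ‖y‖ = 1) : ‖1 - y⁻¹‖ = ‖1 - y‖ := by
  have hy0 : y ≠ 0 := norm_pos_iff.mp (by rw [hy]; exact one_pos)
  have : (1 : F) - y⁻¹ = -(y⁻¹ * (1 - y)) := by field_simp; ring
  rw [this, norm_neg, norm_mul, norm_inv, hy, inv_one, one_mul]

omit instF in
/-- `‖1 - y^c‖ ≤ ‖1 - y‖` for a principal unit `y` and `c ∈ ℤ`. [folklore] -/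
theorem norm_one_sub_zpow_le {y : F} (hy : ‖1 - y‖ < 1) (c : ℤ) : ‖1 - y ^ c‖ ≤ ‖1 - y‖ := by
  rcases Int.eq_nat_or_neg c with ⟨k, rfl | rfl⟩
  · rw [zpow_natCast]
    exact norm_one_sub_pow_le hy k
  · rw [zpow_neg, zpow_natCast,
      norm_one_sub_inv_eq (by rw [norm_pow, norm_eq_one_of_norm_one_sub_lt hy, one_pow])]
    exact norm_one_sub_pow_le hy k

variable [CompleteSpace F]

omit [IsUltrametricDist F] in
/-- `u^{p^k} → 1` for a principal unit `u` of a complete ultrametric `ℚ_p`-algebra (from the limit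
formula `(u^{p^k} - 1)/p^k → L(u)` of the tree's Iwasawa logarithm and `p^k → 0`).
[cite: Washington1997, §5.1] -/
theorem tendsto_pow_prime_pow_nhds_one {u : F} (hu : ‖1 - u‖ < 1) :
    Tendsto (fun k : ℕ => u ^ p ^ k) atTop (𝓝 1) := by
  haveI := IwasawaLog.charZero p (F := F)
  have hp0 : (p : F) ≠ 0 := by exact_mod_cast (Fact.out : p.Prime).ne_zero
  have h1 := (IwasawaLog.tendsto_pow_prime_pow_sub_one_div (p := p) u hu).mul
    (IwasawaLog.tendsto_prime_pow_zero (p := p) (F := F))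
  rw [mul_zero] at h1
  have h2 : (fun k : ℕ => (u ^ p ^ k - 1) / (p : F) ^ k * (p : F) ^ k) = fun k => u ^ p ^ k - 1 := by
    funext k
    rw [div_mul_cancel₀ _ (pow_ne_zero _ hp0)]
  rw [h2] at h1
  simpa using h1.add_const 1

omit [IsUltrametricDist F] in
/-- `‖1 - u^{p^k}‖ → 0` for a principal unit `u`. [cite: Washington1997, §5.1] -/
theorem tendsto_norm_one_sub_pow_prime_pow {u : F} (hu : ‖1 - u‖ < 1) :
    Tendsto (fun k : ℕ => ‖1 - u ^ p ^ k‖) atTop (𝓝 0) := by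
  have h := (tendsto_const_nhds (x := (1 : F))).sub (tendsto_pow_prime_pow_nhds_one (p := p) hu)
  rw [sub_self] at h
  simpa using h.norm

/-- **Teichmüller splitting of a character, without residue fields.** Let `G` be a group,
`g : G →* Fˣ` a homomorphism into the units of a COMPLETE ultrametric `ℚ_p`-algebra, `P` the
principal units and `T ≥ 1` prime to `p` with every `g(σ)^T ∈ P`. Then there is a homomorphism
`ω : G →* Fˣ` with `ω^T = 1`, `g · ω⁻¹` `P`-valued, and `ω(σ) = 1` whenever `g(σ) ∈ P` (so
`ker ω ⊇ g⁻¹(P)` and `ω` is locally constant as soon as `g` is continuous). Construction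
(Washington §5.1, `ω(a) = lim a^{p^n}`, adapted): `ω(σ) = lim_n g(σ)^{e_n}` with `e_n ≡ 1 (mod T)`,
`p^n ∣ e_n` (Chinese remainder); `e_m ≡ e_n (mod T p^n)` makes `n ↦ g(σ)^{e_n}` Cauchy
(`g(σ)^{T p^n c} = (u^{p^n})^c`, `u = g(σ)^T ∈ P`, `u^{p^n} → 1`), `ω(σ)^T = lim u^{e_n} = 1`, and
`g(σ) ω(σ)⁻¹ = lim u^{-(e_n-1)/T}`-type elements of `P` at distance `≤ ‖1 - u‖ < 1` from `1`.
[cite: Washington1997, §5.1 (Teichmüller character)] -/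
theorem exists_teichmueller_splitting {G : Type*} [Group G] (g : G →* Fˣ) (P : Subgroup Fˣ)
    (hP : ∀ u : Fˣ, u ∈ P ↔ ‖1 - (u : F)‖ < 1) {T : ℕ} (hT : 0 < T) (hcop : p.Coprime T)
    (hgT : ∀ σ : G, (g σ) ^ T ∈ P) :
    ∃ ω : G →* Fˣ, (∀ σ, (ω σ) ^ T = 1) ∧ (∀ σ, g σ * (ω σ)⁻¹ ∈ P) ∧ (∀ σ, g σ ∈ P → ω σ = 1) := by
  classical
  have hp : p.Prime := Fact.out
  -- exponents `e n ≡ 1 (mod T)`, `e n ≡ 0 (mod p^n)`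
  have hco : ∀ n : ℕ, T.Coprime (p ^ n) := fun n => (Nat.Coprime.pow_right n hcop.symm)
  let e : ℕ → ℕ := fun n => (Nat.chineseRemainder (hco n) 1 0 : ℕ)
  have he1 : ∀ n, e n ≡ 1 [MOD T] := fun n => (Nat.chineseRemainder (hco n) 1 0).prop.1
  have he0 : ∀ n, e n ≡ 0 [MOD p ^ n] := fun n => (Nat.chineseRemainder (hco n) 1 0).prop.2
  have hpdvd : ∀ n, (p ^ n : ℤ) ∣ (e n : ℤ) := fun n => by
    have := (Nat.modEq_iff_dvd.mp (he0 n).symm)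
    simpa using this
  have hdiff : ∀ {n m : ℕ}, n ≤ m → ((T * p ^ n : ℕ) : ℤ) ∣ (e m : ℤ) - (e n : ℤ) := fun {n m} hnm => by
    have h1 : e n ≡ e m [MOD T] := (he1 n).trans (he1 m).symm
    have h2 : e n ≡ e m [MOD p ^ n] := by
      refine (he0 n).trans ?_
      have := (he0 m).symm
      exact (Nat.ModEq.of_dvd (pow_dvd_pow p hnm) this)
    exact Nat.modEq_iff_dvd.mp ((Nat.modEq_and_modEq_iff_modEq_mul (hco n)).mp ⟨h1, h2⟩)
  -- the approximating characters `a n σ = g(σ)^{e n}` (units) and their key estimate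
  let a : ℕ → G → Fˣ := fun n σ => (g σ) ^ (e n : ℤ)
  have hu : ∀ σ, ‖1 - ((g σ : Fˣ) : F) ^ T‖ < 1 := fun σ => by
    have h := (hP _).mp (hgT σ)
    rwa [Units.val_pow_eq_pow_val] at h
  have hnorm1 : ∀ σ, ‖((g σ : Fˣ) : F)‖ = 1 := fun σ => by
    have h := norm_eq_one_of_norm_one_sub_lt (hu σ)
    rw [norm_pow] at h
    exact (pow_eq_one_iff_of_nonneg (norm_nonneg _) hT.ne').mp h
  have hne0 : ∀ σ, ((g σ : Fˣ) : F) ≠ 0 := fun σ => (g σ).ne_zero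
  -- the approximating sequence `A n σ = g(σ)^{e n}` and its increments
  let A : ℕ → G → F := fun n σ => ((g σ : Fˣ) : F) ^ e n
  have hA_norm : ∀ n σ, ‖A n σ‖ = 1 := fun n σ => by
    simp only [A, norm_pow, hnorm1, one_pow]
  have hA_step : ∀ σ {n m : ℕ}, n ≤ m →
      ‖A m σ - A n σ‖ ≤ ‖1 - (((g σ : Fˣ) : F) ^ T) ^ p ^ n‖ := by
    intro σ n m hnm
    obtain ⟨c, hc⟩ := hdiff hnm
    set x : F := ((g σ : Fˣ) : F) with hx
    have hem : (e m : ℤ) = (e n : ℤ) + ((T * p ^ n : ℕ) : ℤ) * c := by linarith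
    have hAm : A m σ = A n σ * ((x ^ T) ^ p ^ n) ^ c := by
      simp only [A]
      rw [← zpow_natCast x (e m), hem, zpow_add₀ (hne0 σ), zpow_natCast, zpow_mul, ← pow_mul,
        zpow_natCast]
    have hw : ‖1 - (x ^ T) ^ p ^ n‖ < 1 := (norm_one_sub_pow_le (hu σ) _).trans_lt (hu σ)
    rw [hAm, ← mul_sub_one, norm_mul, hA_norm, one_mul, norm_sub_rev]
    exact norm_one_sub_zpow_le hw c
  have hε : ∀ σ, Tendsto (fun n : ℕ => ‖1 - (((g σ : Fˣ) : F) ^ T) ^ p ^ n‖) atTop (𝓝 0) :=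
    fun σ => tendsto_norm_one_sub_pow_prime_pow (p := p) (hu σ)
  -- Cauchy, hence convergent in the complete `F`
  have hcauchy : ∀ σ, CauchySeq fun n => A n σ := fun σ => by
    refine Metric.cauchySeq_iff'.mpr fun ε hεpos => ?_
    obtain ⟨N, hN⟩ := (Metric.tendsto_atTop.mp (hε σ)) ε hεpos
    refine ⟨N, fun n hn => ?_⟩
    have h1 := hN N le_rfl
    rw [Real.dist_eq, sub_zero, abs_of_nonneg (norm_nonneg _)] at h1
    rw [dist_eq_norm]
    exact (hA_step σ hn).trans_lt h1
  have hlim : ∀ σ, ∃ L : F, Tendsto (fun n => A n σ) atTop (𝓝 L) := fun σ =>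
    cauchySeq_tendsto_of_complete (hcauchy σ)
  choose t ht using hlim
  -- `t` is multiplicative with `t 1 = 1` and `‖t σ‖ = 1`
  have ht_one : t 1 = 1 := by
    refine tendsto_nhds_unique (ht 1) ?_
    simp only [A, map_one, Units.val_one, one_pow]
    exact tendsto_const_nhds
  have ht_mul : ∀ σ τ, t (σ * τ) = t σ * t τ := fun σ τ => by
    refine tendsto_nhds_unique (ht (σ * τ)) ?_
    have : (fun n => A n (σ * τ)) = fun n => A n σ * A n τ := by
      funext n; simp only [A, map_mul, Units.val_mul, mul_pow]
    rw [this]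
    exact (ht σ).mul (ht τ)
  have ht_norm : ∀ σ, ‖t σ‖ = 1 := fun σ => by
    have h1 := (ht σ).norm
    have h2 : Tendsto (fun n => ‖A n σ‖) atTop (𝓝 1) := by
      simp only [hA_norm]; exact tendsto_const_nhds
    exact tendsto_nhds_unique h1 h2
  have ht_ne : ∀ σ, t σ ≠ 0 := fun σ => norm_pos_iff.mp (by rw [ht_norm]; exact one_pos)
  -- the homomorphism `ω`
  let ω : G →* Fˣ :=
    { toFun := fun σ => Units.mk0 (t σ) (ht_ne σ)
      map_one' := Units.ext (by simp [ht_one])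
      map_mul' := fun σ τ => Units.ext (by simp [ht_mul]) }
  have hω : ∀ σ, ((ω σ : Fˣ) : F) = t σ := fun σ => rfl
  refine ⟨ω, fun σ => ?_, fun σ => ?_, fun σ hσ => ?_⟩
  · -- `ω(σ)^T = 1`: `A n σ ^ T = u^{e n}` with `p^n ∣ e n`, and `u^{p^n} → 1`
    apply Units.ext
    rw [Units.val_pow_eq_pow_val, hω, Units.val_one]
    refine tendsto_nhds_unique ((ht σ).pow T) ?_
    have hform : ∀ n, A n σ ^ T = (((g σ : Fˣ) : F) ^ T) ^ e n := fun n => by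
      simp only [A]; rw [← pow_mul, ← pow_mul, mul_comm]
    rw [show (fun n => A n σ ^ T) = fun n => (((g σ : Fˣ) : F) ^ T) ^ e n from funext hform]
    refine Metric.tendsto_atTop.mpr fun ε hεpos => ?_
    obtain ⟨N, hN⟩ := (Metric.tendsto_atTop.mp (hε σ)) ε hεpos
    refine ⟨N, fun n hn => ?_⟩
    obtain ⟨d, hd⟩ : p ^ n ∣ e n := (Nat.modEq_zero_iff_dvd.mp (he0 n))
    have h1 := hN n hn
    rw [Real.dist_eq, sub_zero, abs_of_nonneg (norm_nonneg _)] at h1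
    rw [dist_eq_norm, norm_sub_rev, hd, pow_mul]
    exact (norm_one_sub_pow_le ((norm_one_sub_pow_le (hu σ) _).trans_lt (hu σ)) d).trans_lt h1
  · -- `g(σ) ω(σ)⁻¹ ∈ P`: `A n σ · g(σ)⁻¹ = u^{q}`, `q ∈ ℤ`, stays within `‖1 - ·‖ ≤ ‖1 - u‖ < 1`
    set x : F := ((g σ : Fˣ) : F) with hx
    set ρ : ℝ := ‖1 - x ^ T‖ with hρ
    have hρ1 : ρ < 1 := hu σ
    have hmem : ∀ n, ‖1 - A n σ * x⁻¹‖ ≤ ρ := fun n => by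
      obtain ⟨q, hq⟩ : (T : ℤ) ∣ (e n : ℤ) - 1 := by
        have := Nat.modEq_iff_dvd.mp (he1 n).symm
        simpa using this
      have hform : A n σ * x⁻¹ = (x ^ T) ^ q := by
        simp only [A]
        rw [← zpow_natCast x (e n), ← zpow_neg_one, ← zpow_add₀ (hne0 σ), ← sub_eq_add_neg, hq,
          zpow_mul, zpow_natCast]
      rw [hform]
      exact norm_one_sub_zpow_le (hu σ) q
    have hclosed : IsClosed {y : F | ‖1 - y‖ ≤ ρ} :=
      isClosed_le (continuous_const.sub continuous_id).norm continuous_const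
    have hlim' : Tendsto (fun n => A n σ * x⁻¹) atTop (𝓝 (t σ * x⁻¹)) := (ht σ).mul tendsto_const_nhds
    have hmem' : t σ * x⁻¹ ∈ {y : F | ‖1 - y‖ ≤ ρ} :=
      hclosed.mem_of_tendsto hlim' (Filter.Eventually.of_forall hmem)
    have hinv : ω σ * (g σ)⁻¹ ∈ P := by
      rw [hP, Units.val_mul, Units.val_inv_eq_inv_val, hω]
      exact (Set.mem_setOf_eq ▸ hmem').trans_lt hρ1
    have := P.inv_mem hinv
    rwa [mul_inv_rev, inv_inv] at this
  · -- `g(σ) ∈ P ⟹ ω(σ) = 1`: `‖1 - g(σ)^{e n}‖ ≤ ‖1 - g(σ)^{p^n}‖ → 0`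
    apply Units.ext
    rw [hω, Units.val_one]
    refine tendsto_nhds_unique (ht σ) ?_
    have hσ' : ‖1 - ((g σ : Fˣ) : F)‖ < 1 := (hP _).mp hσ
    have hε' := tendsto_norm_one_sub_pow_prime_pow (p := p) hσ'
    refine Metric.tendsto_atTop.mpr fun ε hεpos => ?_
    obtain ⟨N, hN⟩ := (Metric.tendsto_atTop.mp hε') ε hεpos
    refine ⟨N, fun n hn => ?_⟩
    obtain ⟨d, hd⟩ : p ^ n ∣ e n := (Nat.modEq_zero_iff_dvd.mp (he0 n))
    have h1 := hN n hn
    rw [Real.dist_eq, sub_zero, abs_of_nonneg (norm_nonneg _)] at h1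
    simp only [A]
    rw [dist_eq_norm, norm_sub_rev, hd, pow_mul]
    exact (norm_one_sub_pow_le ((norm_one_sub_pow_le hσ' _).trans_lt hσ') d).trans_lt h1

end Teichmueller

/-! ### §5. `ℤ_p`-powers of a principal unit -/

section ZpPow

variable [CompleteSpace F]

/-- **`ℤ_p`-powers of a principal unit.** For `b ∈ F` with `‖1 - b‖ < 1` (`F` a complete ultrametric
`ℚ_p`-algebra) there is a continuous character `χ : ℤ_p → Fˣ`, `x ↦ b^x`, with `χ(1) = b` and all
values in the ball `‖1 - b^x‖ ≤ ‖1 - b‖` — Mathlib's Mahler-series character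
`PadicInt.addChar_of_value_at_one (b - 1)` (`(b-1)^n → 0`), whose values on the dense `ℕ ⊂ ℤ_p` are
the powers `b^n`. [cite: Washington1997, §5.1] -/
theorem exists_zpPow {b : F} (hb : ‖1 - b‖ < 1) :
    ∃ χ : Multiplicative ℤ_[p] →* Fˣ, Continuous χ ∧ ((χ (Multiplicative.ofAdd 1) : Fˣ) : F) = b ∧
      ∀ x, ‖1 - ((χ x : Fˣ) : F)‖ ≤ ‖1 - b‖ := by
  -- `F` as a bounded `ℤ_p`-algebra
  letI : Algebra ℤ_[p] F := ((algebraMap ℚ_[p] F).comp (algebraMap ℤ_[p] ℚ_[p])).toAlgebra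
  have hsmul : ∀ (z : ℤ_[p]) (x : F), z • x = algebraMap ℚ_[p] F (z : ℚ_[p]) * x := fun z x => rfl
  haveI : IsBoundedSMul ℤ_[p] F := by
    refine IsBoundedSMul.of_norm_smul_le fun z x => ?_
    rw [hsmul, norm_mul, norm_algebraMap', PadicInt.padic_norm_e_of_padicInt]
  set r : F := b - 1 with hr
  have hr1 : ‖r‖ < 1 := by rw [hr, ← norm_neg, neg_sub]; exact hb
  have hrt : Tendsto (fun n : ℕ => r ^ n) atTop (𝓝 0) := tendsto_pow_atTop_nhds_zero_of_norm_lt_one hr1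
  set κ : AddChar ℤ_[p] F := PadicInt.addChar_of_value_at_one r hrt with hκ
  have hκc : Continuous κ := PadicInt.continuous_addChar_of_value_at_one hrt
  have hκ1 : κ 1 = b := by rw [hκ, PadicInt.addChar_of_value_at_one_def hrt, hr, add_sub_cancel]
  -- the character into the units
  let χ : Multiplicative ℤ_[p] →* Fˣ := κ.toMonoidHom.toHomUnits
  have hχ : ∀ x : Multiplicative ℤ_[p], ((χ x : Fˣ) : F) = κ x.toAdd := fun x => rfl
  refine ⟨χ, ?_, by rw [hχ]; exact hκ1, fun x => ?_⟩
  · refine Units.continuous_iff.mpr ⟨?_, ?_⟩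
    · exact hκc.comp continuous_toAdd
    · have : (fun x : Multiplicative ℤ_[p] => ((χ x)⁻¹ : Fˣ).val) = fun x => κ (-x.toAdd) := by
        funext x
        rw [← map_inv, hχ, toAdd_inv]
      rw [this]
      exact hκc.comp (continuous_neg.comp continuous_toAdd)
  · -- the closed condition `‖1 - κ y‖ ≤ ‖1 - b‖` holds on `ℕ`, dense in `ℤ_p`
    rw [hχ]
    have hclosed : IsClosed {y : ℤ_[p] | ‖1 - κ y‖ ≤ ‖1 - b‖} :=
      isClosed_le (continuous_const.sub hκc).norm continuous_const
    have hnat : ∀ n : ℕ, ‖1 - κ n‖ ≤ ‖1 - b‖ := fun n => by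
      rw [← nsmul_one, AddChar.map_nsmul_eq_pow, hκ1]
      exact norm_one_sub_pow_le hb n
    have hdense : Dense {y : ℤ_[p] | ‖1 - κ y‖ ≤ ‖1 - b‖} := by
      refine PadicInt.denseRange_natCast.mono ?_
      rintro y ⟨n, rfl⟩
      exact hnat n
    have := hclosed.closure_eq ▸ hdense.closure_eq
    have hmem : x.toAdd ∈ {y : ℤ_[p] | ‖1 - κ y‖ ≤ ‖1 - b‖} := by rw [this]; exact Set.mem_univ _
    exact hmem

end ZpPow

end Summit.BirchSwinnertonDyer.Rank1Residual.X11b.Three.LambdaSupply.PadicUnits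

end
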